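import Literature.NumberTheory.GaloisRepresentations.AbsIntegersEquiv
import Literature.NumberTheory.GaloisRepresentations.ArtinRestriction
import Literature.NumberTheory.GaloisRepresentations.FrobeniusPlaces
import Literature.NumberTheory.QuadraticFields.SquareRootGenerator
import HarnessLib

/-!
# Inertia groups of `Γ_K` seen from two quadratic extensions with a common completion

Topic `Literature/NumberTheory/GaloisRepresentations`; theorems only (no definition, no named fact),
a companion of `AbsIntegersEquiv` / `FrobeniusPlaces` / `QuadraticInertia`.  Let `K` be a number
field, `𝔓` a prime of `\bar ℤ_K` above the finite place `v`, `I_𝔓 ≤ Γ_K` its inertia group, and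
`F = K(θ)`, `F₁ = K(θ₁)` two quadratic extensions with `θ² = c`, `θ₁² = c₁` (so that
`F₂ = K(θθ₁)` is the third quadratic subfield of the biquadratic `F F₁`).  Write
`res_F : Γ_F → Γ_K`, `res₁ : Γ_{F₁} → Γ_K` for the restrictions (`absGaloisRestrict`; their images
are the stabilisers of `e(θ)`, `e₁(θ₁)` for the embeddings `e`, `e₁` of
`exists_mem_range_absGaloisRestrict_iff`).  The elementary fact formalised here is:

> if `I_𝔓` fixes `e(θ) e₁(θ₁)` — e.g. because `c c₁ = N² m` with `m ≡ 1 (mod 4)` prime to `𝔓`, i.e.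
> `v` is unramified in `F₂` — then **`I_𝔓 ∩ res_F(Γ_F) = I_𝔓 ∩ res₁(Γ_{F₁})`**: the inertia at `𝔓`
> of `F̄/F` and of `F̄₁/F₁` is the same subgroup of `Γ_K`.  (Locally: `F ⊗ K_v ≅ F₁ ⊗ K_v`.)

Consequently (`FramedGaloisRep.isUnramifiedAt_restrictField_of_inertia_inf_range_le`) a Galois
representation `σ` of `Γ_K` whose restriction to `Γ_F` is unramified at the place `w` of `F` above
`v` — assumed to be the ONLY place of `F` above `v`, as when `v` ramifies in the quadratic `F`
(`HeightOneSpectrum.eq_of_not_isUnramifiedIn_of_prime`) — has restriction to `Γ_{F₁}` unramified at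
every place of `F₁` above `v`.  The criterion for `I_𝔓` to fix a square root is
`smul_eq_self_of_mem_inertia_of_sq_eq` (a square root `s` of an integer `m ≡ 1 (mod 4)` with
`m ∉ 𝔓` is fixed by `I_𝔓`: `(1+s)/2` is an algebraic integer and `g s = -s` would put `s`, hence
`m`, in `𝔓`) — the unramifiedness of `K(√m)` above `v ∤ m` for `m ≡ 1 (mod 4)`, including `v ∣ 2`.

Written for the seat of `Langlands1980_quadraticBaseChange_frobCompatible`
(`Automorphic/QuadraticBaseChangeFrobCompatibleCarayolProofs`): at a prime `ℓ` ramified in an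
imaginary quadratic `F`, the ramification of `ρ|_{Γ_F}` above `ℓ` is read on `ρ|_{Γ_{F₁}}` for an
auxiliary REAL quadratic `F₁` with `F₁ ⊗ ℚ_ℓ ≅ F ⊗ ℚ_ℓ`.

## References

* J. Neukirch, *Algebraic Number Theory* (1999), Ch. I §8 (quadratic fields), §9 (9.4)–(9.6)
  (inertia groups and intermediate fields). [NeukirchANT1999]
* D. A. Marcus, *Number Fields* (2018), Ch. 2 Thm. 1 and Ch. 4 Thm. 28. [Marcus2018]
-/

noncomputable section

open scoped NumberField Polynomial
open NumberField IsDedekindDomain Field Polynomial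

namespace Literature.NumberTheory.GaloisRepresentations

/-! ### Inertia fixes the square roots of integers `m ≡ 1 (mod 4)` prime to it -/

section SquareRoot

variable {K : Type*} [Field K] [NumberField K]

/-- An element of `\bar ℤ_K` lying in a prime `𝔓` together with a Bézout complement of `1` forces
`1 ∈ 𝔓`: if `a m + b q = 1` in `ℤ` with `m, q ∈ 𝔓` then `𝔓 = ⊤`. [folklore] -/
theorem intCast_not_mem_of_intCast_mem {𝔓 : Ideal (absIntegers (𝓞 K) K)} [𝔓.IsPrime]
    {m q a b : ℤ} (hab : a * m + b * q = 1) (hq : ((q : absIntegers (𝓞 K) K)) ∈ 𝔓) :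
    ((m : absIntegers (𝓞 K) K)) ∉ 𝔓 := by
  intro hm
  apply Ideal.IsPrime.ne_top ‹𝔓.IsPrime›
  rw [Ideal.eq_top_iff_one]
  have h1 : ((a : absIntegers (𝓞 K) K)) * m + b * q = 1 := by exact_mod_cast hab
  rw [← h1]
  exact 𝔓.add_mem (𝔓.mul_mem_left _ hm) (𝔓.mul_mem_left _ hq)

/-- **Inertia fixes `√m` for `m ≡ 1 (mod 4)` prime to it.**  Let `𝔓` be a prime of `\bar ℤ_K`,
`s ∈ K̄` with `s² = m`, `m = 4k + 1` an integer not lying in `𝔓`.  Then every `g ∈ I_𝔓` fixes `s`: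
`t = (1+s)/2` is a root of `X² - X - k`, hence an algebraic integer; `g s = ± s`, and `g s = -s`
would give `g t - t = -s ∈ 𝔓`, so `m = s² ∈ 𝔓`.  (This is the unramifiedness above `𝔓` of
`K(√m)/K`, `m ≡ 1 (mod 4)`, at primes not dividing `m` — also above `2`.)  Neukirch I §8; Marcus
Ch. 2 Thm. 1. [cite: NeukirchANT1999, Ch. I §8] -/
theorem smul_eq_self_of_mem_inertia_of_sq_eq {𝔓 : Ideal (absIntegers (𝓞 K) K)} [𝔓.IsPrime]
    {s : AlgebraicClosure K} {m k : ℤ} (hmk : m = 4 * k + 1)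
    (hs : s ^ 2 = (m : AlgebraicClosure K)) (hm : ((m : absIntegers (𝓞 K) K)) ∉ 𝔓)
    {g : absoluteGaloisGroup K} (hg : g ∈ 𝔓.inertia (absoluteGaloisGroup K)) : g • s = s := by
  -- `s` and `t = (1+s)/2` are algebraic integers
  have hsZ : IsIntegral ℤ s := by
    refine ⟨X ^ 2 - C m, monic_X_pow_sub_C _ two_ne_zero, ?_⟩
    rw [eval₂_sub, eval₂_X_pow, eval₂_C, eq_intCast, hs, sub_self]
  set t : AlgebraicClosure K := (1 + s) / 2 with ht
  have htZ : IsIntegral ℤ t := by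
    refine ⟨X ^ 2 - X - C k, ?_, ?_⟩
    · have h : (X ^ 2 - X - C k : ℤ[X]) = X ^ 2 - (X + C k) := by ring
      rw [h]
      exact monic_X_pow_sub (by compute_degree!)
    · have hm' : ((4 * k + 1 : ℤ) : AlgebraicClosure K) = (m : AlgebraicClosure K) := by rw [hmk]
      have key : t ^ 2 - t - (k : AlgebraicClosure K) =
          (s ^ 2 - ((4 * k + 1 : ℤ) : AlgebraicClosure K)) / 4 := by
        rw [ht]; push_cast; ring
      rw [eval₂_sub, eval₂_sub, eval₂_X_pow, eval₂_X, eval₂_C, eq_intCast, key, hm', hs, sub_self,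
        zero_div]
  have hsI : s ∈ absIntegers (𝓞 K) K := by
    rw [mem_integralClosure_iff]; exact hsZ.tower_top
  have htI : t ∈ absIntegers (𝓞 K) K := by
    rw [mem_integralClosure_iff]; exact htZ.tower_top
  -- `g s = ± s`
  have hgs2 : (g • s) ^ 2 = (m : AlgebraicClosure K) := by
    rw [absoluteGaloisGroup.smul_def, ← map_pow, hs, map_intCast]
  have hpm : g • s = s ∨ g • s = -s := by
    have h0 : (g • s - s) * (g • s + s) = 0 := by
      have : (g • s) ^ 2 - s ^ 2 = 0 := by rw [hgs2, hs, sub_self]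
      linear_combination this
    rcases mul_eq_zero.mp h0 with h | h
    · exact Or.inl (sub_eq_zero.mp h)
    · exact Or.inr (eq_neg_of_add_eq_zero_left h)
  rcases hpm with h | h
  · exact h
  · -- `g s = -s`: then `g t - t = -s ∈ 𝔓`, so `s ∈ 𝔓` and `m = s² ∈ 𝔓`
    exfalso
    apply hm
    have h1 : g • (⟨t, htI⟩ : absIntegers (𝓞 K) K) - ⟨t, htI⟩ ∈ 𝔓 := hg ⟨t, htI⟩
    have h2 : g • (⟨t, htI⟩ : absIntegers (𝓞 K) K) - ⟨t, htI⟩ = -⟨s, hsI⟩ := by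
      apply Subtype.ext
      rw [AddSubgroupClass.coe_sub, integralClosure.coe_smul, NegMemClass.coe_neg]
      change g • t - t = -s
      rw [ht, absoluteGaloisGroup.smul_def, map_div₀, map_add, map_one, map_ofNat,
        ← absoluteGaloisGroup.smul_def, h]
      ring
    rw [h2, neg_mem_iff] at h1
    have h3 : ((m : absIntegers (𝓞 K) K)) = ⟨s, hsI⟩ * ⟨s, hsI⟩ := by
      apply Subtype.ext
      change ((m : absIntegers (𝓞 K) K) : AlgebraicClosure K) = s * s
      rw [← pow_two, hs]
      rfl
    rw [h3]
    exact 𝔓.mul_mem_left _ h1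

end SquareRoot

/-! ### The image of `Γ_F → Γ_K` for a quadratic `F = K(θ)` is the stabiliser of `e(θ)` -/

section Stabiliser

variable {K : Type*} [Field K] {F : Type*} [Field F] [Algebra K F]

/-- **`res(Γ_F)` is the stabiliser of `e(θ)`**: for a quadratic `F = K(θ)` (`θ ∉ K`) and the
`K`-embedding `e : F → K̄` of `exists_mem_range_absGaloisRestrict_iff` (`res(Γ_F) = Gal(K̄/e(F))`),
`g ∈ res(Γ_F)` iff `g` fixes `e(θ)` (every element of `F` is `a + bθ`, `a, b ∈ K`). [folklore] -/
theorem mem_range_absGaloisRestrict_iff_smul_gen_eq (h2 : Module.finrank K F = 2) {θ : F}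
    (hθ : θ ∉ Set.range (algebraMap K F)) {e : F →ₐ[K] AlgebraicClosure K}
    (he : ∀ g : absoluteGaloisGroup K, g ∈ (absGaloisRestrict K F).range ↔ ∀ x : F, g • e x = e x)
    (g : absoluteGaloisGroup K) : g ∈ (absGaloisRestrict K F).range ↔ g • e θ = e θ := by
  rw [he]
  refine ⟨fun h ↦ h θ, fun h x ↦ ?_⟩
  obtain ⟨a, b, rfl⟩ := QuadraticFields.Quadratic.exists_eq_add_mul h2 hθ x
  rw [map_add, map_mul, AlgHom.commutes, AlgHom.commutes, absoluteGaloisGroup.smul_def, map_add,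
    map_mul, AlgEquiv.commutes, AlgEquiv.commutes, ← absoluteGaloisGroup.smul_def, h]

variable {F₁ : Type*} [Field F₁] [Algebra K F₁]

/-- **Two quadratic extensions with a common local behaviour have the same inertia**: if
`F = K(θ)`, `F₁ = K(θ₁)` are quadratic (`θ ∉ K`, `θ₁ ∉ K`), `e`, `e₁` the embeddings describing
`res(Γ_F)`, `res₁(Γ_{F₁})` as stabilisers, and a subgroup `S ≤ Γ_K` fixes the product
`e(θ) e₁(θ₁)` (a generator of the third quadratic subfield of `F F₁`), then
`S ∩ res(Γ_F) = S ∩ res₁(Γ_{F₁})`: for `g ∈ S`, `g` fixes `e(θ)` iff it fixes `e₁(θ₁)`.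
Used with `S = I_𝔓` (`smul_eq_self_of_mem_inertia_of_sq_eq`). [cite: NeukirchANT1999, Ch. I §9 (9.4)] -/
theorem inf_range_absGaloisRestrict_eq_of_smul_mul_eq (h2 : Module.finrank K F = 2) {θ : F}
    (hθ : θ ∉ Set.range (algebraMap K F)) {e : F →ₐ[K] AlgebraicClosure K}
    (he : ∀ g : absoluteGaloisGroup K, g ∈ (absGaloisRestrict K F).range ↔ ∀ x : F, g • e x = e x)
    (h2' : Module.finrank K F₁ = 2) {θ₁ : F₁} (hθ₁ : θ₁ ∉ Set.range (algebraMap K F₁))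
    {e₁ : F₁ →ₐ[K] AlgebraicClosure K}
    (he₁ : ∀ g : absoluteGaloisGroup K, g ∈ (absGaloisRestrict K F₁).range ↔ ∀ x : F₁, g • e₁ x = e₁ x)
    {S : Subgroup (absoluteGaloisGroup K)} (hS : ∀ g ∈ S, g • (e θ * e₁ θ₁) = e θ * e₁ θ₁) :
    S ⊓ (absGaloisRestrict K F).range = S ⊓ (absGaloisRestrict K F₁).range := by
  have hθ0 : e θ ≠ 0 := fun h ↦ QuadraticFields.Quadratic.ne_zero_of_not_mem_range hθ
    ((map_eq_zero_iff e e.toRingHom.injective).mp h)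
  have hθ₁0 : e₁ θ₁ ≠ 0 := fun h ↦ QuadraticFields.Quadratic.ne_zero_of_not_mem_range hθ₁
    ((map_eq_zero_iff e₁ e₁.toRingHom.injective).mp h)
  ext g
  simp only [Subgroup.mem_inf]
  refine ⟨fun ⟨hgS, hg⟩ ↦ ⟨hgS, ?_⟩, fun ⟨hgS, hg⟩ ↦ ⟨hgS, ?_⟩⟩
  · rw [mem_range_absGaloisRestrict_iff_smul_gen_eq h2 hθ he] at hg
    rw [mem_range_absGaloisRestrict_iff_smul_gen_eq h2' hθ₁ he₁]
    have h1 := hS g hgS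
    rw [smul_mul', hg] at h1
    exact mul_left_cancel₀ hθ0 h1
  · rw [mem_range_absGaloisRestrict_iff_smul_gen_eq h2' hθ₁ he₁] at hg
    rw [mem_range_absGaloisRestrict_iff_smul_gen_eq h2 hθ he]
    have h1 := hS g hgS
    rw [smul_mul', hg] at h1
    exact mul_right_cancel₀ hθ₁0 h1

end Stabiliser

/-! ### Unramifiedness of `σ|_{Γ_{F₁}}` read on `σ|_{Γ_F}` -/

section Transfer

variable {K : Type*} [Field K] [NumberField K] {F : Type*} [Field F] [NumberField F] [Algebra K F]
  {F₁ : Type*} [Field F₁] [Algebra K F₁]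
  {A : Type*} [CommRing A] [TopologicalSpace A] {n : ℕ}

/-- **Transfer of unramifiedness between two extensions sharing their inertia above `v`.**  Let
`σ : Γ_K → GL_n(A)`, `v` a finite place of `K`, and suppose that for every prime `𝔓 ∣ v` of
`\bar ℤ_K`, `I_𝔓 ∩ res₁(Γ_{F₁}) ⊆ res(Γ_F)` (e.g. `I_𝔓 ∩ res(Γ_F) = I_𝔓 ∩ res₁(Γ_{F₁})`,
`inf_range_absGaloisRestrict_eq_of_smul_mul_eq`).  If `w` is the ONLY place of `F` above `v` and
`σ|_{Γ_F}` is unramified at `w`, then `σ|_{Γ_{F₁}}` is unramified at every place of `F₁` above `v`: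
an inertia element `δ ∈ I_{𝔔₁}`, `𝔔₁ ∣ λ ∣ v`, has `res₁ δ ∈ I_𝔓` for `𝔓 = ι₁⁻¹𝔔₁ ∣ v`, hence
`res₁ δ = res γ` with `γ ∈ res⁻¹(I_𝔓) = I_𝔔` for the prime `𝔔 = ι 𝔓` of `\bar ℤ_F`, which lies
above the place `w` (`AbsIntegersEquiv`).  (Places of `F₁` are called `u` below.) [cite: NeukirchANT1999, Ch. I §9 (9.4)–(9.6)] -/
theorem FramedGaloisRep.isUnramifiedAt_restrictField_of_inertia_inf_range_le
    (σ : FramedGaloisRep K A n) {v : HeightOneSpectrum (𝓞 K)}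
    (hI : ∀ 𝔓 ∈ v.primesAbove,
      𝔓.inertia (absoluteGaloisGroup K) ⊓ (absGaloisRestrict K F₁).range ≤ (absGaloisRestrict K F).range)
    {w : HeightOneSpectrum (𝓞 F)}
    (huniq : ∀ w' : HeightOneSpectrum (𝓞 F), w'.asIdeal.under (𝓞 K) = v.asIdeal → w' = w)
    (hσ : (σ.restrictField F).IsUnramifiedAt w)
    {u : HeightOneSpectrum (𝓞 F₁)} (hu : u.asIdeal.under (𝓞 K) = v.asIdeal) :
    (σ.restrictField F₁).IsUnramifiedAt u := by
  haveI : Algebra.IsAlgebraic K F := Algebra.IsAlgebraic.tower_top (K := ℚ) K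
  intro 𝔔₁ h𝔔₁ δ hδ
  haveI : 𝔔₁.IsPrime := h𝔔₁.1
  -- `𝔓 = ι₁⁻¹ 𝔔₁ ∣ v` and `res₁ δ ∈ I_𝔓 ∩ res₁(Γ_{F₁}) ⊆ res(Γ_F)`
  have h𝔓 : 𝔔₁.comap (absIntegersMap K F₁) ∈ v.primesAbove := comap_absIntegersMap_mem_primesAbove hu h𝔔₁
  have hres₁ : absGaloisRestrict K F₁ δ ∈ (𝔔₁.comap (absIntegersMap K F₁)).inertia (absoluteGaloisGroup K) :=
    absGaloisRestrict_mem_inertia_comap K F₁ hδ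
  obtain ⟨γ, hγ⟩ : absGaloisRestrict K F₁ δ ∈ (absGaloisRestrict K F).range :=
    hI _ h𝔓 ⟨hres₁, δ, rfl⟩
  replace hγ : absGaloisRestrict K F γ = absGaloisRestrict K F₁ δ := hγ
  -- `𝔔 = ι 𝔓`, a prime of `\bar ℤ_F` above the unique place `w`
  haveI : (𝔔₁.comap (absIntegersMap K F₁)).IsPrime := h𝔓.1
  obtain ⟨𝔔, h𝔔prime, h𝔔⟩ := exists_isPrime_comap_absIntegersMap_eq K F (𝔔₁.comap (absIntegersMap K F₁))
  haveI := h𝔔prime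
  obtain ⟨w', hw', h𝔔w', -⟩ :=
    exists_heightOneSpectrum_of_comap_absIntegersMap_mem_primesAbove (K := K) (M := F) (𝔔 := 𝔔)
      (h𝔔.symm ▸ h𝔓)
  obtain rfl : w' = w := huniq w' hw'
  -- `γ ∈ res⁻¹(I_𝔓) = I_𝔔`, killed by `σ|_{Γ_F}`
  have hγI : γ ∈ 𝔔.inertia (absoluteGaloisGroup F) := by
    rw [← comap_inertia_comap_absIntegersMap K F 𝔔, Subgroup.mem_comap, h𝔔]
    change absGaloisRestrict K F γ ∈ _
    rw [hγ]
    exact hres₁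
  have h1 : (σ.restrictField F) γ = 1 := hσ 𝔔 h𝔔w' γ hγI
  rw [FramedGaloisRep.restrictField_apply, hγ] at h1
  rw [FramedGaloisRep.restrictField_apply]
  exact h1

/-- **Over a place that ramifies in a Galois extension of prime degree there is only one place**
(`e f g = l` with `e ≠ 1` forces `e = l`, `f = g = 1`; cf.
`HeightOneSpectrum.inertiaDeg_eq_one_of_not_isUnramifiedIn` of `BaseChangeStrongAllFinite`).
[folklore] -/
theorem HeightOneSpectrum.eq_of_not_isUnramifiedIn_of_prime [IsGalois K F]
    (hl : (Module.finrank K F).Prime) {v : HeightOneSpectrum (𝓞 K)}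
    (hram : ¬ Algebra.IsUnramifiedIn (𝓞 F) v.asIdeal) {w w' : HeightOneSpectrum (𝓞 F)}
    (hw : w.asIdeal.under (𝓞 K) = v.asIdeal) (hw' : w'.asIdeal.under (𝓞 K) = v.asIdeal) :
    w = w' := by
  classical
  haveI : IsGaloisGroup (F ≃ₐ[K] F) (𝓞 K) (𝓞 F) := IsGaloisGroup.of_isFractionRing _ _ _ K F
  haveI : v.asIdeal.IsMaximal := v.isMaximal
  -- `e ≠ 1`
  have he : v.asIdeal.ramificationIdxIn (𝓞 F) ≠ 1 := by
    intro h1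
    apply hram
    rw [Algebra.isUnramifiedIn_iff_forall_ramificationIdx_eq_one]
    intro Q _ hQ
    haveI := hQ
    rw [← Ideal.ramificationIdxIn_eq_ramificationIdx v.asIdeal Q (F ≃ₐ[K] F)]
    exact h1
  -- `g e f = l`, `e ∣ l`, so `e = l` and `g f = 1`
  have hfund := Ideal.ncard_primesOver_mul_ramificationIdxIn_mul_inertiaDegIn v.asIdeal (𝓞 F)
    (F ≃ₐ[K] F)
  rw [IsGalois.card_aut_eq_finrank] at hfund
  have hediv : v.asIdeal.ramificationIdxIn (𝓞 F) ∣ Module.finrank K F :=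
    ⟨(v.asIdeal.primesOver (𝓞 F)).ncard * v.asIdeal.inertiaDegIn (𝓞 F), by rw [← hfund]; ring⟩
  have heℓ : v.asIdeal.ramificationIdxIn (𝓞 F) = Module.finrank K F :=
    ((Nat.dvd_prime hl).1 hediv).resolve_left he
  have hpos : 0 < Module.finrank K F := Module.finrank_pos
  have hg1 : (v.asIdeal.primesOver (𝓞 F)).ncard = 1 := by
    have h2 : (v.asIdeal.primesOver (𝓞 F)).ncard * v.asIdeal.inertiaDegIn (𝓞 F) *
        Module.finrank K F = 1 * Module.finrank K F := by
      rw [one_mul]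
      calc (v.asIdeal.primesOver (𝓞 F)).ncard * v.asIdeal.inertiaDegIn (𝓞 F) * Module.finrank K F
          = (v.asIdeal.primesOver (𝓞 F)).ncard * v.asIdeal.ramificationIdxIn (𝓞 F) *
              v.asIdeal.inertiaDegIn (𝓞 F) := by rw [heℓ]; ring
        _ = Module.finrank K F := by rw [mul_assoc]; exact hfund
    exact Nat.eq_one_of_mul_eq_one_right (Nat.eq_of_mul_eq_mul_right hpos h2)
  -- both `w` and `w'` lie in the singleton `primesOver v`
  obtain ⟨Q, hQ⟩ := Set.ncard_eq_one.mp hg1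
  have hmem : ∀ u : HeightOneSpectrum (𝓞 F), u.asIdeal.under (𝓞 K) = v.asIdeal →
      u.asIdeal ∈ v.asIdeal.primesOver (𝓞 F) := fun u hu ↦ ⟨u.isPrime, ⟨hu.symm⟩⟩
  apply HeightOneSpectrum.ext
  have h1 := hmem w hw
  have h2 := hmem w' hw'
  rw [hQ, Set.mem_singleton_iff] at h1 h2
  rw [h1, h2]

end Transfer

end Literature.NumberTheory.GaloisRepresentations

end
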